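import Mathlib
import Summits.Ventures.HodgeRepro2.Hypothesis

/-!
# The principal congruence subgroup `Γ(𝔑)` has finite index in `U(L)_𝓞` (and is normal there)

The ideal-level form of the Tier-3 hypothesis shape `IsFiniteIndexSubgroupOf` of
`Hypothesis.lean`, for the groups of DR15 Definition 1.3 recorded there:
`integralUnitaryGroup K H` = the elements of the unitary group with entrywise integral `γ` and
`γ⁻¹` (written `U(L)_𝓞` below), and `principalCongruence K H 𝔑` = `Γ(𝔑)`, those with
`γ ≡ 1 (mod 𝔑)` entrywise (`CongruentToOne`).

* `integralUnitaryGroupSubgroup K H`: `U(L)_𝓞` is a subgroup of `GL_m(K)` (entrywise integrality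
  is closed under products by `IsIntegral.sum` / `IsIntegral.mul`).
* `intLift γ hγ`: the entrywise lift of an integral matrix to `𝓞 K`; it is multiplicative.
* `congruenceReduction H 𝔑 γ` = `(intLift γ).map (Ideal.Quotient.mk 𝔑)`, the reduction mod `𝔑`,
  and `congruenceReductionHom H 𝔑 : U(L)_𝓞 →* GL_m(𝓞 K ⧸ 𝔑)`.
* `congruenceReduction_eq_one_iff`: the reduction is `1` iff `CongruentToOne K 𝔑 γ`, so
  `principalCongruenceSubgroup H 𝔑` (carrier `principalCongruence K H 𝔑`) is a subgroup and
  `congruenceReductionHom_ker` identifies it with the kernel; hence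
  `normal_subgroupOf_principalCongruence` (`Γ(𝔑) ⊴ U(L)_𝓞`).
* `finiteIndex_subgroupOf_principalCongruence` and **`isFiniteIndexSubgroupOf_principalCongruence`**:
  `[U(L)_𝓞 : Γ(𝔑)] < ∞` for `𝔑 ≠ ⊥` (`𝓞 K ⧸ 𝔑` is finite by Mathlib's
  `Ideal.finiteQuotientOfFreeOfNeBot`, so `GL_m(𝓞 K ⧸ 𝔑)` is finite);
  `isFiniteIndexSubgroupOf_principalCongruence_of_le`: `[Γ(𝔑') : Γ(𝔑)] < ∞` for `𝔑 ≤ 𝔑'`.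
* `principalCongruence_subset_congruence₁`, `congruence₁_subset_congruence₀`: the DR15 inclusions
  `Γ(𝔑) ⊆ Γ_1(𝔑) ⊆ Γ_0(𝔑)`.

Everything is proved; no new axioms.
-/

namespace Summit.Ventures.HodgeRepro2.ShimuraData

open Matrix NumberField

section IntegralMatrices

variable {K : Type*} [Field K] {m : ℕ}

/-! ### Entrywise integral matrices and their lift to `𝓞 K` -/

/-- Entries of a product of entrywise integral matrices are integral. -/
theorem isIntegral_entries_mul (γ γ' : Matrix (Fin m) (Fin m) K)
    (hγ : ∀ i j, IsIntegral ℤ (γ i j)) (hγ' : ∀ i j, IsIntegral ℤ (γ' i j)) :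
    ∀ i j, IsIntegral ℤ ((γ * γ') i j) := fun i j => by
  rw [Matrix.mul_apply]
  exact IsIntegral.sum _ fun k _ => (hγ i k).mul (hγ' k j)

/-- Entries of the identity matrix are integral. -/
theorem isIntegral_entries_one : ∀ i j, IsIntegral ℤ ((1 : Matrix (Fin m) (Fin m) K) i j) :=
  fun i j => by
  rw [Matrix.one_apply]
  split_ifs
  · exact isIntegral_one
  · exact isIntegral_zero

/-- The entrywise lift of an entrywise integral matrix over `K` to `𝓞 K`. -/
def intLift (γ : Matrix (Fin m) (Fin m) K) (hγ : ∀ i j, IsIntegral ℤ (γ i j)) :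
    Matrix (Fin m) (Fin m) (𝓞 K) := fun i j => ⟨γ i j, hγ i j⟩

/-- The lift maps back to the entries of `γ`. -/
@[simp] theorem algebraMap_intLift (γ : Matrix (Fin m) (Fin m) K)
    (hγ : ∀ i j, IsIntegral ℤ (γ i j)) (i j : Fin m) :
    algebraMap (𝓞 K) K (intLift γ hγ i j) = γ i j := rfl

/-- The lift is multiplicative. -/
theorem intLift_mul (γ γ' : Matrix (Fin m) (Fin m) K) (hγ : ∀ i j, IsIntegral ℤ (γ i j))
    (hγ' : ∀ i j, IsIntegral ℤ (γ' i j)) (hγγ' : ∀ i j, IsIntegral ℤ ((γ * γ') i j)) :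
    intLift (γ * γ') hγγ' = intLift γ hγ * intLift γ' hγ' := by
  ext i j
  simp only [RingOfIntegers.coe_eq_algebraMap, algebraMap_intLift, Matrix.mul_apply, map_sum,
    map_mul]

/-- The lift of the identity is the identity. -/
theorem intLift_one (h₁ : ∀ i j, IsIntegral ℤ ((1 : Matrix (Fin m) (Fin m) K) i j)) :
    intLift 1 h₁ = 1 := by
  ext i j
  simp only [RingOfIntegers.coe_eq_algebraMap, algebraMap_intLift, Matrix.one_apply]
  split_ifs <;> simp

/-- The identity matrix over `𝓞 K` maps to the identity matrix over `K`, entrywise. -/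
theorem algebraMap_one_apply (i j : Fin m) :
    algebraMap (𝓞 K) K ((1 : Matrix (Fin m) (Fin m) (𝓞 K)) i j) =
      (1 : Matrix (Fin m) (Fin m) K) i j := by
  rw [Matrix.one_apply, Matrix.one_apply]
  split_ifs <;> simp

/-- `CongruentToOne K 𝔑 γ` (as printed in `Hypothesis.lean`) says exactly that the lift of `γ`
is `≡ 1 (mod 𝔑)` entrywise. -/
theorem congruentToOne_iff_sub_one_mem (𝔑 : Ideal (𝓞 K)) (γ : Matrix (Fin m) (Fin m) K)
    (hγ : ∀ i j, IsIntegral ℤ (γ i j)) :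
    CongruentToOne K 𝔑 γ ↔
      ∀ i j, intLift γ hγ i j - (1 : Matrix (Fin m) (Fin m) (𝓞 K)) i j ∈ 𝔑 := by
  constructor
  · intro h i j
    obtain ⟨a, ha, hij⟩ := h i j
    have : intLift γ hγ i j - (1 : Matrix (Fin m) (Fin m) (𝓞 K)) i j = a := by
      apply RingOfIntegers.ext
      rw [RingOfIntegers.coe_eq_algebraMap, RingOfIntegers.coe_eq_algebraMap, map_sub,
        algebraMap_intLift, algebraMap_one_apply, hij]
    rwa [this]
  · intro h i j
    exact ⟨_, h i j, by rw [map_sub, algebraMap_intLift, algebraMap_one_apply]⟩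

/-- `𝓞 K ⧸ 𝔑` is finite for `𝔑 ≠ ⊥`. -/
theorem finite_quotient_ringOfIntegers [NumberField K] (𝔑 : Ideal (𝓞 K)) (h𝔑 : 𝔑 ≠ ⊥) :
    Finite (𝓞 K ⧸ 𝔑) :=
  Ideal.finiteQuotientOfFreeOfNeBot 𝔑 h𝔑

end IntegralMatrices

section Groups

variable {K : Type*} [Field K] [NumberField K] [NumberField.IsCMField K]
variable {m : ℕ} (H : Matrix (Fin m) (Fin m) K)

/-! ### `U(L)_𝓞` as a subgroup -/

/-- `integralUnitaryGroup K H` (`U(L)_𝓞`) as a subgroup of `GL_m(K)`. -/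
def integralUnitaryGroupSubgroup : Subgroup (GL (Fin m) K) where
  carrier := integralUnitaryGroup K H
  mul_mem' := by
    rintro γ γ' ⟨hu, hi, hi'⟩ ⟨hu', hj, hj'⟩
    refine ⟨(unitaryGroup K H).mul_mem hu hu', ?_, ?_⟩
    · exact isIntegral_entries_mul _ _ hi hj
    · rw [_root_.mul_inv_rev, Units.val_mul]
      exact isIntegral_entries_mul _ _ hj' hi'
  one_mem' := ⟨(unitaryGroup K H).one_mem, isIntegral_entries_one, by
    rw [inv_one]; exact isIntegral_entries_one⟩
  inv_mem' := by
    rintro γ ⟨hu, hi, hi'⟩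
    exact ⟨(unitaryGroup K H).inv_mem hu, hi', by rw [inv_inv]; exact hi⟩

/-- The carrier of `integralUnitaryGroupSubgroup` is `integralUnitaryGroup`. -/
@[simp] theorem coe_integralUnitaryGroupSubgroup :
    (integralUnitaryGroupSubgroup H : Set (GL (Fin m) K)) = integralUnitaryGroup K H := rfl

/-- Membership in `integralUnitaryGroupSubgroup`. -/
theorem mem_integralUnitaryGroupSubgroup {γ : GL (Fin m) K} :
    γ ∈ integralUnitaryGroupSubgroup H ↔ γ ∈ integralUnitaryGroup K H := Iff.rfl

/-- An element of `U(L)_𝓞` has integral entries. -/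
theorem isIntegral_entries_of_mem {γ : GL (Fin m) K} (hγ : γ ∈ integralUnitaryGroup K H) :
    ∀ i j, IsIntegral ℤ ((γ : Matrix (Fin m) (Fin m) K) i j) := hγ.2.1

/-! ### Reduction mod `𝔑` -/

variable (𝔑 : Ideal (𝓞 K))

/-- The reduction mod `𝔑` of `γ ∈ U(L)_𝓞`: lift the entries to `𝓞 K` and reduce. -/
def congruenceReduction (γ : integralUnitaryGroupSubgroup H) :
    Matrix (Fin m) (Fin m) (𝓞 K ⧸ 𝔑) :=
  (intLift ((γ : GL (Fin m) K) : Matrix (Fin m) (Fin m) K) (isIntegral_entries_of_mem H γ.2)).map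
    (Ideal.Quotient.mk 𝔑)

/-- The reduction is multiplicative. -/
theorem congruenceReduction_mul (γ γ' : integralUnitaryGroupSubgroup H) :
    congruenceReduction H 𝔑 (γ * γ') = congruenceReduction H 𝔑 γ * congruenceReduction H 𝔑 γ' := by
  unfold congruenceReduction
  rw [← Matrix.map_mul]
  congr 1
  exact intLift_mul _ _ _ _ _

/-- The reduction of `1` is `1`. -/
theorem congruenceReduction_one : congruenceReduction H 𝔑 1 = 1 := by
  unfold congruenceReduction
  rw [← Matrix.map_one (Ideal.Quotient.mk 𝔑) (map_zero _) (map_one _)]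
  congr 1
  exact intLift_one _

/-- The reduction is `1` iff `γ ≡ 1 (mod 𝔑)` in the sense of `CongruentToOne`. -/
theorem congruenceReduction_eq_one_iff (γ : integralUnitaryGroupSubgroup H) :
    congruenceReduction H 𝔑 γ = 1 ↔ CongruentToOne K 𝔑 ((γ : GL (Fin m) K) : Matrix (Fin m) (Fin m) K) := by
  rw [congruentToOne_iff_sub_one_mem 𝔑 _ (isIntegral_entries_of_mem H γ.2)]
  unfold congruenceReduction
  rw [← Matrix.map_one (Ideal.Quotient.mk 𝔑) (map_zero _) (map_one _)]
  constructor
  · intro h i j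
    have := congrFun (congrFun h i) j
    simp only [Matrix.map_apply] at this
    exact Ideal.Quotient.eq.1 this
  · intro h
    ext i j
    simp only [Matrix.map_apply]
    exact Ideal.Quotient.eq.2 (h i j)

/-- The reduction of `γ ∈ U(L)_𝓞` as a unit: the reduction of `γ⁻¹` is its inverse. -/
def congruenceReductionUnit (γ : integralUnitaryGroupSubgroup H) :
    (Matrix (Fin m) (Fin m) (𝓞 K ⧸ 𝔑))ˣ where
  val := congruenceReduction H 𝔑 γ
  inv := congruenceReduction H 𝔑 γ⁻¹
  val_inv := by rw [← congruenceReduction_mul, mul_inv_cancel, congruenceReduction_one]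
  inv_val := by rw [← congruenceReduction_mul, inv_mul_cancel, congruenceReduction_one]

/-- `U(L)_𝓞 → GL_m(𝓞 K ⧸ 𝔑)`, reduction mod `𝔑`, as a group homomorphism. -/
def congruenceReductionHom :
    integralUnitaryGroupSubgroup H →* (Matrix (Fin m) (Fin m) (𝓞 K ⧸ 𝔑))ˣ where
  toFun := congruenceReductionUnit H 𝔑
  map_one' := Units.ext (congruenceReduction_one H 𝔑)
  map_mul' γ γ' := Units.ext (congruenceReduction_mul H 𝔑 γ γ')

/-- The value of `congruenceReductionHom`. -/
@[simp] theorem coe_congruenceReductionHom (γ : integralUnitaryGroupSubgroup H) :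
    (congruenceReductionHom H 𝔑 γ : Matrix (Fin m) (Fin m) (𝓞 K ⧸ 𝔑)) =
      congruenceReduction H 𝔑 γ := rfl

/-- `congruenceReductionHom γ = 1` iff the reduction of `γ` is `1`. -/
theorem congruenceReductionHom_eq_one_iff (γ : integralUnitaryGroupSubgroup H) :
    congruenceReductionHom H 𝔑 γ = 1 ↔ congruenceReduction H 𝔑 γ = 1 := by
  rw [Units.ext_iff, coe_congruenceReductionHom, Units.val_one]

/-! ### `Γ(𝔑)` as a subgroup, its normality and finite index -/

/-- `principalCongruence K H 𝔑` (`Γ(𝔑)`) as a subgroup of `GL_m(K)`. -/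
def principalCongruenceSubgroup : Subgroup (GL (Fin m) K) where
  carrier := principalCongruence K H 𝔑
  mul_mem' := by
    rintro γ γ' ⟨hγ, hc⟩ ⟨hγ', hc'⟩
    refine ⟨(integralUnitaryGroupSubgroup H).mul_mem hγ hγ', ?_⟩
    have h := (congruenceReduction_eq_one_iff H 𝔑 ⟨γ, hγ⟩).2 hc
    have h' := (congruenceReduction_eq_one_iff H 𝔑 ⟨γ', hγ'⟩).2 hc'
    exact (congruenceReduction_eq_one_iff H 𝔑 (⟨γ, hγ⟩ * ⟨γ', hγ'⟩)).1
      (by rw [congruenceReduction_mul, h, h', one_mul])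
  one_mem' :=
    ⟨(integralUnitaryGroupSubgroup H).one_mem,
      (congruenceReduction_eq_one_iff H 𝔑 1).1 (congruenceReduction_one H 𝔑)⟩
  inv_mem' := by
    rintro γ ⟨hγ, hc⟩
    refine ⟨(integralUnitaryGroupSubgroup H).inv_mem hγ, ?_⟩
    have h := (congruenceReduction_eq_one_iff H 𝔑 ⟨γ, hγ⟩).2 hc
    have hmul := congruenceReduction_mul H 𝔑 (⟨γ, hγ⟩ : integralUnitaryGroupSubgroup H)⁻¹ ⟨γ, hγ⟩
    rw [inv_mul_cancel, congruenceReduction_one, h, mul_one] at hmul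
    exact (congruenceReduction_eq_one_iff H 𝔑 (⟨γ, hγ⟩ : integralUnitaryGroupSubgroup H)⁻¹).1
      hmul.symm

/-- The carrier of `principalCongruenceSubgroup` is `principalCongruence`. -/
@[simp] theorem coe_principalCongruenceSubgroup :
    (principalCongruenceSubgroup H 𝔑 : Set (GL (Fin m) K)) = principalCongruence K H 𝔑 := rfl

/-- `Γ(𝔑) ≤ U(L)_𝓞`. -/
theorem principalCongruenceSubgroup_le :
    principalCongruenceSubgroup H 𝔑 ≤ integralUnitaryGroupSubgroup H := fun _ h => h.1

/-- `Γ(𝔑) ⊆ Γ(𝔑')` for `𝔑 ≤ 𝔑'`. -/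
theorem principalCongruence_subset_of_le {𝔑' : Ideal (𝓞 K)} (h : 𝔑 ≤ 𝔑') :
    principalCongruence K H 𝔑 ⊆ principalCongruence K H 𝔑' := by
  rintro γ ⟨hγ, hc⟩
  refine ⟨hγ, fun i j => ?_⟩
  obtain ⟨a, ha, hij⟩ := hc i j
  exact ⟨a, h ha, hij⟩

/-- `Γ(𝔑) ≤ Γ(𝔑')` for `𝔑 ≤ 𝔑'`, as subgroups. -/
theorem principalCongruenceSubgroup_le_of_le {𝔑' : Ideal (𝓞 K)} (h : 𝔑 ≤ 𝔑') :
    principalCongruenceSubgroup H 𝔑 ≤ principalCongruenceSubgroup H 𝔑' :=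
  fun _ hγ => principalCongruence_subset_of_le H 𝔑 h hγ

/-- The kernel of the reduction mod `𝔑` is `Γ(𝔑)` (inside `U(L)_𝓞`). -/
theorem congruenceReductionHom_ker :
    (congruenceReductionHom H 𝔑).ker =
      (principalCongruenceSubgroup H 𝔑).subgroupOf (integralUnitaryGroupSubgroup H) := by
  ext γ
  rw [MonoidHom.mem_ker, Subgroup.mem_subgroupOf, congruenceReductionHom_eq_one_iff,
    congruenceReduction_eq_one_iff]
  exact ⟨fun h => ⟨γ.2, h⟩, fun h => h.2⟩

/-- `Γ(𝔑)` is normal in `U(L)_𝓞`. -/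
theorem normal_subgroupOf_principalCongruence :
    ((principalCongruenceSubgroup H 𝔑).subgroupOf (integralUnitaryGroupSubgroup H)).Normal := by
  rw [← congruenceReductionHom_ker]
  exact MonoidHom.normal_ker _

/-- `[U(L)_𝓞 : Γ(𝔑)] < ∞` for `𝔑 ≠ ⊥`. -/
theorem finiteIndex_subgroupOf_principalCongruence (h𝔑 : 𝔑 ≠ ⊥) :
    ((principalCongruenceSubgroup H 𝔑).subgroupOf (integralUnitaryGroupSubgroup H)).FiniteIndex := by
  haveI := finite_quotient_ringOfIntegers 𝔑 h𝔑
  rw [← congruenceReductionHom_ker]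
  exact Subgroup.finiteIndex_ker _

/-- **`Γ(𝔑)` has finite index in `U(L)_𝓞`**: the `IsFiniteIndexSubgroupOf` hypothesis shape of
`Hypothesis.lean` for the principal congruence subgroup of level `𝔑 ≠ ⊥`. -/
theorem isFiniteIndexSubgroupOf_principalCongruence (h𝔑 : 𝔑 ≠ ⊥) :
    IsFiniteIndexSubgroupOf K (principalCongruence K H 𝔑) (integralUnitaryGroup K H) :=
  ⟨principalCongruenceSubgroup H 𝔑, integralUnitaryGroupSubgroup H, rfl, rfl,
    principalCongruenceSubgroup_le H 𝔑, finiteIndex_subgroupOf_principalCongruence H 𝔑 h𝔑⟩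

/-- `[Γ(𝔑') : Γ(𝔑)] < ∞` for `𝔑 ≤ 𝔑'` and `𝔑 ≠ ⊥` (multiplicativity of the relative index
in the tower `Γ(𝔑) ≤ Γ(𝔑') ≤ U(L)_𝓞`). -/
theorem isFiniteIndexSubgroupOf_principalCongruence_of_le {𝔑' : Ideal (𝓞 K)} (h : 𝔑 ≤ 𝔑')
    (h𝔑 : 𝔑 ≠ ⊥) :
    IsFiniteIndexSubgroupOf K (principalCongruence K H 𝔑) (principalCongruence K H 𝔑') := by
  refine ⟨principalCongruenceSubgroup H 𝔑, principalCongruenceSubgroup H 𝔑', rfl, rfl,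
    principalCongruenceSubgroup_le_of_le H 𝔑 h, ?_⟩
  rw [Subgroup.finiteIndex_iff]
  intro h0
  apply Subgroup.finiteIndex_iff.mp (finiteIndex_subgroupOf_principalCongruence H 𝔑 h𝔑)
  change Subgroup.relIndex _ _ = 0
  rw [← Subgroup.relIndex_mul_relIndex _ _ _ (principalCongruenceSubgroup_le_of_le H 𝔑 h)
    (principalCongruenceSubgroup_le H 𝔑')]
  have h0' : (principalCongruenceSubgroup H 𝔑).relIndex (principalCongruenceSubgroup H 𝔑') = 0 :=
    h0
  rw [h0', zero_mul]

/-! ### The DR15 inclusions `Γ(𝔑) ⊆ Γ_1(𝔑) ⊆ Γ_0(𝔑)` -/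

/-- `Γ_1(𝔑) ⊆ Γ_0(𝔑)`. -/
theorem congruence₁_subset_congruence₀ : congruence₁ K H 𝔑 ⊆ congruence₀ K H 𝔑 :=
  fun _ h => h.1

/-- `Γ(𝔑) ⊆ Γ_1(𝔑)`: `γ ≡ 1 (mod 𝔑)` entrywise gives `γ_{ij} ∈ 𝔑` below the diagonal and
`γ_{ii} - 1 ∈ 𝔑` on it. -/
theorem principalCongruence_subset_congruence₁ :
    principalCongruence K H 𝔑 ⊆ congruence₁ K H 𝔑 := by
  rintro γ ⟨hγ, hc⟩
  refine ⟨⟨hγ, fun i j hij => ?_⟩, fun i => ?_⟩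
  · obtain ⟨a, ha, h⟩ := hc i j
    refine ⟨a, ha, ?_⟩
    rwa [Matrix.one_apply_ne (ne_of_gt hij), sub_zero] at h
  · obtain ⟨a, ha, h⟩ := hc i i
    refine ⟨a, ha, ?_⟩
    rwa [Matrix.one_apply_eq] at h

/-- `Γ(𝔑) ⊆ Γ_0(𝔑)`. -/
theorem principalCongruence_subset_congruence₀ :
    principalCongruence K H 𝔑 ⊆ congruence₀ K H 𝔑 :=
  fun _ h => congruence₁_subset_congruence₀ H 𝔑 (principalCongruence_subset_congruence₁ H 𝔑 h)

end Groups

end Summit.Ventures.HodgeRepro2.ShimuraData
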